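import Literature.Geometry.Riemannian.MCFTranslationInvariance
import Literature.Geometry.Riemannian.LevelSetFlowInnerBarrier
import HarnessLib

/-!
# The level set flow is a weak set flow (existence of the biggest flow)

Topic `Literature/Geometry/Riemannian`. The tree defines White's level set flow of `K₀ ⊆ M`
(`Literature.Geometry.Riemannian.levelSetFlow`, `MeanConvexLevelSetFlow.lean`) as the UNION of all
weak set flows (Hershkovits–White 2020, Def. 19: relatively closed spacetime track + avoidance of
classical mean curvature flows) on `[0, ∞)` starting inside `K₀`, and records as NOT proved the
theorem that this union is itself a weak set flow (White 2000, §2; Ilmanen) — without which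
"the biggest flow" is only an upper bound. This file PROVES it in `ℝⁿ⁺¹` (`n ≥ 1`) for CLOSED
`K₀`:

* `isWeakSetFlowIn_levelSetFlow` — **`t ↦ F_t(K₀)` is a weak set flow in `ℝⁿ⁺¹` on `[0, ∞)`**,
  hence (with `subset_levelSetFlow`) the greatest weak set flow `K` with `K 0 ⊆ K₀`;
* `isClosed_track_levelSetFlow`, `isClosed_levelSetFlow` — its spacetime track and its time
  slices are closed (compact for compact `K₀`, `isCompact_levelSetFlow`); `levelSetFlow_avoidance`
  — classical flows disjoint from `F_a(K₀)` stay disjoint from `F_t(K₀)`.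

Proof (White 2000, §2). Let `C` be the closure of the track `{(x, t) : t ≥ 0, x ∈ F_t(K₀)}` and
`L̄ t = {x : (x, t) ∈ C}`. (1) `L̄` is a weak set flow on `[0, ∞)` (`isWeakSetFlowIn_closureTrack`):
its track is `C`; for avoidance (`disjoint_closureTrack_of_disjoint`), a classical flow `F'` on
`[a, b]` missing the closed `L̄ a` is `δ`-separated from it by compactness, the level set flow then
stays `δ`-away from `F'(t, ·)` on `[a, b]` by QUANTITATIVE avoidance
(`levelSetFlow_le_norm_sub_of_forall`, `MCFTranslationInvariance.lean`: test against all small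
translates of `F'`), and a point of `F'(t, N') ∩ L̄ t` would be a limit of track points `(z, s)`,
`z ∈ F_s(K₀)`, which after BACKWARD REACH from `s` to `min s b`
(`exists_mem_levelSetFlow_dist_le`, from the inner sphere barriers of
`LevelSetFlowInnerBarrier.lean`) are `δ`-far from `F'(min s b, ·) ∋` points converging to the
limit — contradiction. (2) `L̄ 0 ⊆ closure K₀` (`closureTrack_zero_subset`, backward reach again).
(3) For closed `K₀`, maximality gives `L̄ t ⊆ F_t(K₀) ⊆ L̄ t` (`closureTrack_slice_eq_levelSetFlow`),
so the level set flow inherits (1). Everything is PROVED; no definitions, no named facts.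

## References

* B. White, *The size of the singular set in mean curvature flow of mean-convex sets*, J. Amer.
  Math. Soc. 13 (2000), 665–695, §2. [White2000]
* O. Hershkovits, B. White, *Nonfattening of mean curvature flow at singularities of mean convex
  type*, Comm. Pure Appl. Math. 73 (2020), Appendix, Def. 19 and the paragraph after Thm. 20.
  [HershkovitsWhite2019]
* T. Ilmanen, *Elliptic regularization and partial regularity for motion by mean curvature*,
  Mem. Amer. Math. Soc. 108 (1994) (set-theoretic subsolutions; cited for context).
-/

noncomputable section

open Bundle Set Function Metric Module Filter
open scoped Manifold ContDiff Topology RealInnerProductSpace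

namespace Literature.Geometry.Riemannian

open Lorentzian Lorentzian.PseudoRiemannianMetric

variable {n : ℕ}

/-! ### A congruence lemma for weak set flows -/

section Congr

variable {M : Type} [TopologicalSpace M] [ChartedSpace (EuclideanSpace ℝ (Fin (n + 1))) M]
  [IsManifold (𝓡 (n + 1)) ∞ M]
  {g : PseudoRiemannianMetric (𝓡 (n + 1)) ∞ (EuclideanSpace ℝ (Fin (n + 1)))
    (TangentSpace (𝓡 (n + 1)) : M → Type _)} [g.HasLeviCivita]

/-- Weak set flows on `I` depend only on the slices `K t`, `t ∈ I`. [folklore] -/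
theorem IsWeakSetFlowIn.congr {W : Set M} {I : Set ℝ} {K K' : ℝ → Set M}
    (h : IsWeakSetFlowIn g W I K) (hK : ∀ t ∈ I, K' t = K t) : IsWeakSetFlowIn g W I K' := by
  obtain ⟨h1, ⟨C, hC, htr⟩, h3⟩ := h
  refine ⟨fun t ht ↦ (hK t ht).symm ▸ h1 t ht, ⟨C, hC, ?_⟩, ?_⟩
  · rw [← htr]
    ext p
    simp only [mem_setOf_eq]
    constructor
    · rintro ⟨hp, hx⟩; exact ⟨hp, (hK _ hp) ▸ hx⟩
    · rintro ⟨hp, hx⟩; exact ⟨hp, (hK _ hp).symm ▸ hx⟩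
  · intro a b hab hI N _ _ _ F ν hF hW ha t ht
    rw [hK t (hI ht)]
    rw [hK a (hI (left_mem_Icc.2 hab))] at ha
    exact h3 hab hI N F ν hF hW ha t ht

end Congr

/-! ### The closure of the track of the level set flow is a weak set flow -/

section Closure

/-- **Backward reach of the level set flow**: a point of `F_t(K₀)` lies within any `ρ` with
`ρ² > 2n(t - s)` of `F_s(K₀)`, `0 ≤ s ≤ t`. [cite: White2000, §2] -/
theorem exists_mem_levelSetFlow_dist_le (hn : 1 ≤ n) {K₀ : Set (EuclideanSpace ℝ (Fin (n + 1)))}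
    {s t : ℝ} (hs : 0 ≤ s) (hst : s ≤ t) {x : EuclideanSpace ℝ (Fin (n + 1))}
    (hx : x ∈ levelSetFlow (euclideanMetric (EuclideanSpace ℝ (Fin (n + 1)))) K₀ t) {ρ : ℝ}
    (hρpos : 0 < ρ) (hρ : 2 * n * (t - s) < ρ ^ 2) :
    ∃ y ∈ levelSetFlow (euclideanMetric (EuclideanSpace ℝ (Fin (n + 1)))) K₀ s, dist y x ≤ ρ := by
  obtain ⟨-, K, hK, hK0, hxK⟩ := hx
  obtain ⟨y, hy, hyx⟩ := hK.exists_mem_dist_le hn hst (fun r hr ↦ hs.trans hr.1) hxK hρpos hρ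
    (subset_univ _)
  exact ⟨y, subset_levelSetFlow hK hK0 hs hy, hyx⟩

/-- **The time-`0` slice of the closed track lies in `closure K₀`** (backward reach: points of the
flow at small positive times are close to `F_0(K₀) ⊆ K₀`). [cite: White2000, §2] -/
theorem closureTrack_zero_subset (hn : 1 ≤ n) (K₀ : Set (EuclideanSpace ℝ (Fin (n + 1))))
    {x : EuclideanSpace ℝ (Fin (n + 1))}
    (hx : (x, (0 : ℝ)) ∈ closure {p : EuclideanSpace ℝ (Fin (n + 1)) × ℝ |
      0 ≤ p.2 ∧ p.1 ∈ levelSetFlow (euclideanMetric (EuclideanSpace ℝ (Fin (n + 1)))) K₀ p.2}) :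
    x ∈ closure K₀ := by
  have hn0 : (0 : ℝ) < n := by exact_mod_cast hn
  rw [Metric.mem_closure_iff]
  intro ε hε
  -- choose `ε'` with `2ε' + √(2nε') < ε`
  set ε' := min (ε / 4) (ε ^ 2 / (32 * n)) with hε'
  have hε'pos : 0 < ε' := by rw [hε']; positivity
  have hε'1 : ε' ≤ ε / 4 := min_le_left _ _
  have hε'2 : Real.sqrt (2 * n * ε') ≤ ε / 4 := by
    rw [Real.sqrt_le_left (by positivity)]
    have : ε' ≤ ε ^ 2 / (32 * n) := min_le_right _ _
    rw [le_div_iff₀ (by positivity)] at this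
    nlinarith
  obtain ⟨⟨z, s⟩, ⟨hs0, hz⟩, hdist⟩ := Metric.mem_closure_iff.1 hx ε' hε'pos
  rw [Prod.dist_eq, max_lt_iff] at hdist
  obtain ⟨hzx, hs⟩ := hdist
  dsimp only at hs0 hz hzx hs
  rw [Real.dist_eq, zero_sub, abs_neg, abs_lt] at hs
  -- backward reach from time `s` to time `0`
  obtain ⟨y, hy, hyz⟩ := exists_mem_levelSetFlow_dist_le hn le_rfl hs0 hz
    (ρ := Real.sqrt (2 * n * s) + ε') (by positivity) (by
      have h0 : 0 ≤ 2 * n * s := by positivity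
      nlinarith [Real.sq_sqrt h0, Real.sqrt_nonneg (2 * n * s)])
  refine ⟨y, levelSetFlow_zero_subset K₀ hy, ?_⟩
  have hsq : Real.sqrt (2 * n * s) ≤ Real.sqrt (2 * n * ε') :=
    Real.sqrt_le_sqrt (by nlinarith [hs.2])
  calc dist x y ≤ dist x z + dist z y := dist_triangle _ _ _
    _ = dist x z + dist y z := by rw [dist_comm z y]
    _ < ε' + (Real.sqrt (2 * n * s) + ε') := by linarith
    _ ≤ ε := by linarith

/-- **Avoidance for the closed track.** Let `C` be the closure of the track of the level set flow
of `K₀` and `L̄ t = {x : (x, t) ∈ C}`. If a classical flow `F'` on `[a, b]`, `a ≥ 0`, misses `L̄ a`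
at time `a`, it misses `L̄ t` for all `t ∈ [a, b]`. Proof: by compactness `F'(a, N')` and the closed
`L̄ a` are `δ`-separated; by quantitative avoidance (`levelSetFlow_le_norm_sub_of_forall`) the
level set flow stays `δ`-away from `F'(t, ·)` on `[a, b]`; a point `x = F'(t, y₀) ∈ L̄ t` is a limit
of track points `(z, s)`, `z ∈ F_s(K₀)`, which (after backward reach from `s` to `min s b` if
`s > b`) are `δ`-far from `F'(min s b, y₀) → x` — contradiction. [cite: White2000, §2] -/
theorem disjoint_closureTrack_of_disjoint (hn : 1 ≤ n) (K₀ : Set (EuclideanSpace ℝ (Fin (n + 1))))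
    {N' : Type} [TopologicalSpace N'] [ChartedSpace (EuclideanSpace ℝ (Fin n)) N']
    [IsManifold (𝓡 n) ∞ N'] {F' : ℝ → N' → EuclideanSpace ℝ (Fin (n + 1))}
    {ν' : (t : ℝ) → NormalField (𝓡 (n + 1)) (F' t)} {a b : ℝ} (ha : 0 ≤ a)
    (hF' : IsClassicalMCF (euclideanMetric (EuclideanSpace ℝ (Fin (n + 1)))) F' ν' a b)
    (hdis : Disjoint (range (F' a)) {x | (x, a) ∈ closure {p : EuclideanSpace ℝ (Fin (n + 1)) × ℝ |
      0 ≤ p.2 ∧ p.1 ∈ levelSetFlow (euclideanMetric (EuclideanSpace ℝ (Fin (n + 1)))) K₀ p.2}})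
    {t : ℝ} (ht : t ∈ Icc a b) :
    Disjoint (range (F' t)) {x | (x, t) ∈ closure {p : EuclideanSpace ℝ (Fin (n + 1)) × ℝ |
      0 ≤ p.2 ∧ p.1 ∈ levelSetFlow (euclideanMetric (EuclideanSpace ℝ (Fin (n + 1)))) K₀ p.2}} := by
  have hn0 : (0 : ℝ) < n := by exact_mod_cast hn
  set L : ℝ → Set (EuclideanSpace ℝ (Fin (n + 1))) :=
    levelSetFlow (euclideanMetric (EuclideanSpace ℝ (Fin (n + 1)))) K₀ with hL
  set Tr : Set (EuclideanSpace ℝ (Fin (n + 1)) × ℝ) := {p | 0 ≤ p.2 ∧ p.1 ∈ L p.2} with hTr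
  have hab : a ≤ b := ht.1.trans ht.2
  haveI := hF'.compactSpace
  refine Set.disjoint_left.2 fun x hx₁ hx₂ ↦ ?_
  obtain ⟨y₀, rfl⟩ := hx₁
  change (F' t y₀, t) ∈ closure Tr at hx₂
  -- the case `t = a` is the hypothesis
  rcases eq_or_lt_of_le ht.1 with rfl | hat
  · exact Set.disjoint_left.1 hdis (mem_range_self y₀) hx₂
  -- `δ`-separation at time `a`
  have hclosed : IsClosed {x : EuclideanSpace ℝ (Fin (n + 1)) | (x, a) ∈ closure Tr} :=
    isClosed_closure.preimage (Continuous.prodMk_left a)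
  have hcpt : IsCompact (range (F' a)) :=
    isCompact_range (hF'.isSpacelikeImmersion a (left_mem_Icc.2 hab)).contMDiff_self.continuous
  obtain ⟨δ, hδpos, hδ⟩ := hdis.exists_cthickenings hcpt hclosed
  have hfar : ∀ y, ∀ z ∈ L a, δ ≤ ‖F' a y - z‖ := by
    intro y z hz
    by_contra hlt
    rw [not_le] at hlt
    have hz' : z ∈ {x : EuclideanSpace ℝ (Fin (n + 1)) | (x, a) ∈ closure Tr} :=
      subset_closure (⟨ha, hz⟩ : ((z, a) : EuclideanSpace ℝ (Fin (n + 1)) × ℝ) ∈ Tr)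
    have h1 : z ∈ cthickening δ (range (F' a)) :=
      mem_cthickening_of_dist_le z (F' a y) δ _ (mem_range_self y)
        (by rw [dist_comm, dist_eq_norm]; exact hlt.le)
    exact Set.disjoint_left.1 hδ h1 (self_subset_cthickening _ hz')
  have hstar : ∀ s ∈ Icc a b, ∀ y, ∀ z ∈ L s, δ ≤ ‖F' s y - z‖ := fun s hs y z hz ↦
    levelSetFlow_le_norm_sub_of_forall hF' ha hab hfar hs y hz
  -- continuity of the slice at `t` within `[a, b]`
  have hcont := (hF'.continuousOn_slice y₀) t ht
  rw [Metric.continuousWithinAt_iff] at hcont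
  obtain ⟨η, hηpos, hη⟩ := hcont (δ / 4) (by positivity)
  -- the approximation scale
  set ε := min (min η (t - a)) (min (δ / 8) (δ ^ 2 / (128 * n))) with hε
  have hεpos : 0 < ε := by
    rw [hε]
    refine lt_min (lt_min hηpos (by linarith)) (lt_min (by positivity) (by positivity))
  have hεη : ε ≤ η := (min_le_left _ _).trans (min_le_left _ _)
  have hεta : ε ≤ t - a := (min_le_left _ _).trans (min_le_right _ _)
  have hεδ : ε ≤ δ / 8 := (min_le_right _ _).trans (min_le_left _ _)
  have hεsq : Real.sqrt (2 * n * ε) ≤ δ / 8 := by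
    rw [Real.sqrt_le_left (by positivity)]
    have : ε ≤ δ ^ 2 / (128 * n) := (min_le_right _ _).trans (min_le_right _ _)
    rw [le_div_iff₀ (by positivity)] at this
    nlinarith
  -- a track point `(z, s)` within `ε` of `(x, t)`
  obtain ⟨⟨z, s⟩, ⟨hs0, hz⟩, hdist⟩ := Metric.mem_closure_iff.1 hx₂ ε hεpos
  rw [Prod.dist_eq, max_lt_iff] at hdist
  obtain ⟨hzx, hst⟩ := hdist
  dsimp only at hs0 hz hzx hst
  rw [Real.dist_eq, abs_lt] at hst
  have hsa : a ≤ s := by linarith [hst.2]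
  -- the comparison time `s' = min s b ∈ [a, b]` and a point `w ∈ L s'` close to `z`
  set s' := min s b with hs'
  have hs'I : s' ∈ Icc a b := ⟨le_min hsa hab, min_le_right _ _⟩
  have hs't : dist s' t < η := by
    rw [Real.dist_eq, abs_lt, hs']
    rcases le_or_gt s b with hsb | hsb
    · rw [min_eq_left hsb]; constructor <;> linarith [hst.1, hst.2]
    · rw [min_eq_right hsb.le]; constructor <;> linarith [hst.1, ht.2]
  have hw : ∃ w ∈ L s', dist w z ≤ Real.sqrt (2 * n * ε) + ε := by
    rcases le_or_gt s b with hsb | hsb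
    · refine ⟨z, by rwa [hs', min_eq_left hsb], ?_⟩
      rw [dist_self]; positivity
    · rw [hs', min_eq_right hsb.le]
      have hsbε : s - b < ε := by linarith [ht.2, hst.1]
      obtain ⟨w, hw, hwz⟩ := exists_mem_levelSetFlow_dist_le hn (ha.trans hab) hsb.le hz
        (ρ := Real.sqrt (2 * n * (s - b)) + ε) (by positivity) (by
          have h0 : 0 ≤ 2 * n * (s - b) := by nlinarith
          nlinarith [Real.sq_sqrt h0, Real.sqrt_nonneg (2 * n * (s - b))])
      refine ⟨w, hw, hwz.trans ?_⟩
      have : Real.sqrt (2 * n * (s - b)) ≤ Real.sqrt (2 * n * ε) :=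
        Real.sqrt_le_sqrt (by nlinarith)
      linarith
  obtain ⟨w, hwL, hwz⟩ := hw
  -- the contradiction
  have h1 : δ ≤ ‖F' s' y₀ - w‖ := hstar s' hs'I y₀ w hwL
  have h2 : dist (F' s' y₀) (F' t y₀) < δ / 4 := hη hs'I hs't
  have h3 : ‖F' s' y₀ - w‖ ≤ dist (F' s' y₀) (F' t y₀) + dist (F' t y₀) z + dist w z := by
    rw [← dist_eq_norm]
    calc dist (F' s' y₀) w ≤ dist (F' s' y₀) (F' t y₀) + dist (F' t y₀) w := dist_triangle _ _ _
      _ ≤ dist (F' s' y₀) (F' t y₀) + (dist (F' t y₀) z + dist z w) := by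
          linarith [dist_triangle (F' t y₀) z w]
      _ = _ := by rw [dist_comm z w]; ring
  linarith

/-- **The closed-track flow `L̄` of the level set flow is a weak set flow on `[0, ∞)`.**
[cite: White2000, §2] -/
theorem isWeakSetFlowIn_closureTrack (hn : 1 ≤ n) (K₀ : Set (EuclideanSpace ℝ (Fin (n + 1)))) :
    IsWeakSetFlowIn (euclideanMetric (EuclideanSpace ℝ (Fin (n + 1)))) univ (Ici 0)
      fun t ↦ {x | (x, t) ∈ closure {p : EuclideanSpace ℝ (Fin (n + 1)) × ℝ |
        0 ≤ p.2 ∧ p.1 ∈ levelSetFlow (euclideanMetric (EuclideanSpace ℝ (Fin (n + 1)))) K₀ p.2}} := by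
  set Tr : Set (EuclideanSpace ℝ (Fin (n + 1)) × ℝ) := {p | 0 ≤ p.2 ∧
    p.1 ∈ levelSetFlow (euclideanMetric (EuclideanSpace ℝ (Fin (n + 1)))) K₀ p.2} with hTr
  have hC2 : ∀ p ∈ closure Tr, (0 : ℝ) ≤ p.2 := fun p hp ↦
    closure_minimal (fun q (hq : q ∈ Tr) ↦ hq.1) (isClosed_le continuous_const continuous_snd) hp
  refine ⟨fun _ _ ↦ subset_univ _, ⟨closure Tr, isClosed_closure, ?_⟩, ?_⟩
  · ext ⟨x, t⟩
    simp only [mem_setOf_eq, mem_Ici, mem_inter_iff, mem_prod, mem_univ, true_and]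
    constructor
    · rintro ⟨ht, hx⟩; exact ⟨hx, ht⟩
    · rintro ⟨hx, ht⟩; exact ⟨ht, hx⟩
  · intro a b hab hI N' _ _ _ F' ν' hF' _ hdis t ht
    exact disjoint_closureTrack_of_disjoint hn K₀ (hI (left_mem_Icc.2 hab)) hF' hdis ht

end Closure

/-! ### The level set flow of a closed set is a weak set flow with closed track -/

section LevelSet

/-- For CLOSED `K₀`, the slices of the closed track are the level set flow itself:
`{x : (x, t) ∈ closure (track)} = F_t(K₀)` for `t ≥ 0` (the closed-track flow is a weak set flow
from inside `closure K₀ = K₀`, hence below the biggest one). [cite: White2000, §2] -/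
theorem closureTrack_slice_eq_levelSetFlow (hn : 1 ≤ n) {K₀ : Set (EuclideanSpace ℝ (Fin (n + 1)))}
    (hK₀ : IsClosed K₀) {t : ℝ} (ht : 0 ≤ t) :
    {x | (x, t) ∈ closure {p : EuclideanSpace ℝ (Fin (n + 1)) × ℝ |
        0 ≤ p.2 ∧ p.1 ∈ levelSetFlow (euclideanMetric (EuclideanSpace ℝ (Fin (n + 1)))) K₀ p.2}} =
      levelSetFlow (euclideanMetric (EuclideanSpace ℝ (Fin (n + 1)))) K₀ t := by
  refine Subset.antisymm ?_ fun x hx ↦ subset_closure ⟨ht, hx⟩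
  have h0 : {x | (x, (0 : ℝ)) ∈ closure {p : EuclideanSpace ℝ (Fin (n + 1)) × ℝ |
      0 ≤ p.2 ∧ p.1 ∈ levelSetFlow (euclideanMetric (EuclideanSpace ℝ (Fin (n + 1)))) K₀ p.2}} ⊆ K₀ :=
    fun x hx ↦ hK₀.closure_eq ▸ closureTrack_zero_subset hn K₀ hx
  exact subset_levelSetFlow (isWeakSetFlowIn_closureTrack hn K₀) h0 ht

/-- **The level set flow of a closed set is a weak set flow** (existence of the biggest flow;
White 2000, §2, after Ilmanen: "the level set flow is a weak set flow"; not previously available in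
the tree, cf. the module docstring of `MeanConvexLevelSetFlow.lean`): for closed `K₀ ⊆ ℝⁿ⁺¹`,
`n ≥ 1`, `t ↦ F_t(K₀)` is a weak set flow in `ℝⁿ⁺¹` on `[0, ∞)`; together with
`subset_levelSetFlow` it is the GREATEST weak set flow `K` on `[0, ∞)` with `K 0 ⊆ K₀`.
[cite: White2000, §2] [cite: HershkovitsWhite2019, Appendix (after Thm. 20)] -/
theorem isWeakSetFlowIn_levelSetFlow (hn : 1 ≤ n) {K₀ : Set (EuclideanSpace ℝ (Fin (n + 1)))}
    (hK₀ : IsClosed K₀) :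
    IsWeakSetFlowIn (euclideanMetric (EuclideanSpace ℝ (Fin (n + 1)))) univ (Ici 0)
      (levelSetFlow (euclideanMetric (EuclideanSpace ℝ (Fin (n + 1)))) K₀) :=
  (isWeakSetFlowIn_closureTrack hn K₀).congr fun _ ht ↦
    (closureTrack_slice_eq_levelSetFlow hn hK₀ ht).symm

/-- **The spacetime track `{(x, t) : t ≥ 0, x ∈ F_t(K₀)}` of the level set flow of a closed set is
closed.** [cite: White2000, §2] -/
theorem isClosed_track_levelSetFlow (hn : 1 ≤ n) {K₀ : Set (EuclideanSpace ℝ (Fin (n + 1)))}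
    (hK₀ : IsClosed K₀) :
    IsClosed {p : EuclideanSpace ℝ (Fin (n + 1)) × ℝ |
      0 ≤ p.2 ∧ p.1 ∈ levelSetFlow (euclideanMetric (EuclideanSpace ℝ (Fin (n + 1)))) K₀ p.2} := by
  set Tr : Set (EuclideanSpace ℝ (Fin (n + 1)) × ℝ) := {p | 0 ≤ p.2 ∧
    p.1 ∈ levelSetFlow (euclideanMetric (EuclideanSpace ℝ (Fin (n + 1)))) K₀ p.2} with hTr
  suffices h : closure Tr ⊆ Tr from closure_subset_iff_isClosed.1 h
  rintro ⟨x, t⟩ hp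
  have ht : 0 ≤ t :=
    closure_minimal (fun q (hq : q ∈ Tr) ↦ hq.1) (isClosed_le continuous_const continuous_snd) hp
  exact ⟨ht, (closureTrack_slice_eq_levelSetFlow hn hK₀ ht).le hp⟩

/-- **Each time slice `F_t(K₀)` of the level set flow of a closed set is closed.**
[cite: White2000, §2] -/
theorem isClosed_levelSetFlow (hn : 1 ≤ n) {K₀ : Set (EuclideanSpace ℝ (Fin (n + 1)))}
    (hK₀ : IsClosed K₀) (t : ℝ) :
    IsClosed (levelSetFlow (euclideanMetric (EuclideanSpace ℝ (Fin (n + 1)))) K₀ t) := by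
  rcases lt_or_ge t 0 with ht | ht
  · rw [levelSetFlow_of_neg K₀ ht]; exact isClosed_empty
  · rw [← closureTrack_slice_eq_levelSetFlow hn hK₀ ht]
    exact isClosed_closure.preimage (Continuous.prodMk_left t)

/-- **Avoidance principle for the level set flow**: a classical mean curvature flow on `[a, b]`,
`a ≥ 0`, disjoint from `F_a(K₀)` (closed `K₀`) stays disjoint from `F_t(K₀)`, `t ∈ [a, b]`.
[cite: White2000, §2] -/
theorem levelSetFlow_avoidance (hn : 1 ≤ n) {K₀ : Set (EuclideanSpace ℝ (Fin (n + 1)))}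
    (hK₀ : IsClosed K₀) {N' : Type} [TopologicalSpace N'] [ChartedSpace (EuclideanSpace ℝ (Fin n)) N']
    [IsManifold (𝓡 n) ∞ N'] {F' : ℝ → N' → EuclideanSpace ℝ (Fin (n + 1))}
    {ν' : (t : ℝ) → NormalField (𝓡 (n + 1)) (F' t)} {a b : ℝ} (ha : 0 ≤ a) (hab : a ≤ b)
    (hF' : IsClassicalMCF (euclideanMetric (EuclideanSpace ℝ (Fin (n + 1)))) F' ν' a b)
    (hdis : Disjoint (range (F' a))
      (levelSetFlow (euclideanMetric (EuclideanSpace ℝ (Fin (n + 1)))) K₀ a))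
    {t : ℝ} (ht : t ∈ Icc a b) :
    Disjoint (range (F' t)) (levelSetFlow (euclideanMetric (EuclideanSpace ℝ (Fin (n + 1)))) K₀ t) :=
  (isWeakSetFlowIn_levelSetFlow hn hK₀).avoidance hab (fun _ hs ↦ ha.trans hs.1) hF'
    (fun _ _ ↦ subset_univ _) hdis ht


/-- **The level set flow of a compact set has compact time slices** (closed by
`isClosed_levelSetFlow`, bounded by the outer sphere barriers `levelSetFlow_subset_ball`).
[cite: White2000, §2] [cite: EvansSpruck1991, Thm. 7.1 (a)] -/
theorem isCompact_levelSetFlow (hn : 1 ≤ n) {K₀ : Set (EuclideanSpace ℝ (Fin (n + 1)))}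
    (hK₀ : IsCompact K₀) (t : ℝ) :
    IsCompact (levelSetFlow (euclideanMetric (EuclideanSpace ℝ (Fin (n + 1)))) K₀ t) := by
  have hn0 : (0 : ℝ) < n := by exact_mod_cast hn
  obtain ⟨r₀, hr₀⟩ := hK₀.isBounded.subset_ball 0
  -- a ball about `0` containing `K₀`, so big that it is not extinct at time `t`
  set r := max r₀ (Real.sqrt (2 * n * |t|) + 1) with hr
  have hsub : K₀ ⊆ ball 0 r := hr₀.trans (ball_subset_ball (le_max_left _ _))
  have hrt : 2 * n * t < r ^ 2 := by
    have h1 : Real.sqrt (2 * n * |t|) + 1 ≤ r := le_max_right _ _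
    have h2 : 2 * n * t ≤ 2 * n * |t| := by nlinarith [le_abs_self t]
    have h3 : 0 ≤ Real.sqrt (2 * n * |t|) := Real.sqrt_nonneg _
    have h4 := Real.sq_sqrt (show 0 ≤ 2 * n * |t| by positivity)
    nlinarith
  refine Metric.isCompact_of_isClosed_isBounded (isClosed_levelSetFlow hn hK₀.isClosed t) ?_
  exact (isBounded_ball.subset (levelSetFlow_subset_ball hn hsub hrt))

end LevelSet

end Literature.Geometry.Riemannian

end
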